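import Summits.BirchSwinnertonDyer.BirchSwinnertonDyer.Theorems.ClassRecordThreeShimuraKolyvaginOrderBoundAtThreeSurjHOfNamed
import Summits.BirchSwinnertonDyer.BirchSwinnertonDyer.Theorems.ClassRecordThreeShimuraKolyvaginConjugationKLevelOfLabels
import HarnessLib

/-!
# Crux `ShimuraKolyvaginOrderBoundAtThreeSurj` (item stmt-BirchSwinnertonDyer-19899) — the PRIMITIVES aside π₃ with
# FOUR labels: (B3₀) dropped (it is a theorem of (B3) + (B2)), and the by-name closers for that REDUCED aside

Cell `bsd-stepL` (run/shared/lean/pub/bsd-stepL/), seat `bsd-stepL-shim-p2` (prover g5), HELPER for the shared crux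
(`--supports stmt-BirchSwinnertonDyer-19899 --as helper`; K2@3 `route-BirchSwinnertonDyer-ClassRecordThree` + KOLY
`route-BirchSwinnertonDyer-KolyvaginRoadThree`; skeleton v3 b5621f5fb3bef0cc). shim3a g3's canonical PRIMITIVES supplier
π₃ (binder `hPrim` of p496956 ∕ p499393 ∕ p499945: `∃ ι y yK ε degy`, display (B1), `ε = ±1`, labels (B2) (B3) (B3₀) (B4)
(B5)) carries the `K`-level conjugation label (B3₀) `∀ c ≠ 1, IsOfFinAddOrder (c·y_K − ε·y_K)` as a SEPARATE printed
clause. By this seat's `ShimuraKolyvaginConjKLevel.isOfFinAddOrder_map_sub_smul_of_labels` (p501287) that clause FOLLOWS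
from (B3) at `m = 1` and (B2). Hence:

* `shimuraPrimitives_of_reduced : π₃ᴿ → π₃` — where **π₃ᴿ = π₃ with the (B3₀) conjunct DELETED and nothing else
  changed** (text VERBATIM otherwise, shim3a's binder order);
* the RULING-5 closers for the REDUCED aside, one line each on top of shim3a's p499393 ∕ p499945:
  `stub_orderBoundSurj_heegnerPointAtThree_of_poitouTate_of_GZK_of_modularity_of_casselsTateLevelInputs_of_reducedPrimitives`
  (H VERBATIM ⟸ hPT → hGZK → hE → hCTf → π₃ᴿ), `shimuraKolyvaginOrderBoundAtThreeSurj_of_…_reducedPrimitives` (K2@3 ROUTE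
  DECL BY NAME, same binders), `kolyvaginRoadThree_…_reducedPrimitives` (KOLY twin).

So IF the planner holds the four-label text π₃ᴿ as the Shimura aside of the 19899 DOWN (one printed clause fewer than π₃;
referee: (B3₀)'s locator Gross 1991 §5 ∕ Darmon 3.11 leaves the aside, (B3) BD96 Prop. 2.6 ∕ Gross 5.3 stays), the item
`…SurjR := PT → GZK → modularity → (∀ K, casselsTate_levelInputs K) → π₃ᴿ → ‹19899›` is born CLOSED BY NAME by this file;
if it holds π₃, shim3a's p499945 closes it and this file is unused. Planner's call; nothing is re-filed here.

HONEST FRAMING: CONDITIONAL on the binders (π₃ᴿ, `casselsTate_levelInputs`, PT, GZK, modularity — all print-shaped,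
none discharged); nothing about `X_{N⁺,N⁻}` is constructed; item 19899 stays OPEN; BSD is not proved; no census number
moves (T7).
[cite: GrossLMS1991, §3 (p. 238), §4 (4.1), §5 Prop. 5.3] [cite: BertoliniDarmon1996, §2.5, Prop. 2.6]
[cite: CaiShuTian2014, Thm. 1.5] [cite: Nekovar2007, (4.8), (4.9)] [cite: McCallumLMS1991, §1 Theorem (Kolyvagin)]
[cite: MilneADT2006, Ch. I Thm. 4.10(b), §6 Thm. 6.13(a)] [cite: JetchevSkinnerWan2017, Thm. 4.4.1 (p. 19)]
presearch: as p501287 ∕ p496956; `lean search 'reducedPrimitives|_of_reduced'` → none.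
-/

noncomputable section

open scoped Classical AddSubgroup
set_option linter.dupNamespace false
namespace Summit.BirchSwinnertonDyer.BirchSwinnertonDyer.Theorems.ShimuraKolyvaginSurjPrimitivesReduced

open WeierstrassCurve NumberField IsDedekindDomain Field Function CongruenceSubgroup
  Literature.NumberTheory.Automorphic Literature.NumberTheory.EllipticCurves.ModularForms
  Literature.NumberTheory.EllipticCurves Literature.NumberTheory.EllipticCurves.KolyvaginCocycle
  Literature.NumberTheory.EllipticCurves.KolyvaginEuler
  Literature.NumberTheory.EllipticCurves.KolyvaginDescent
  Literature.NumberTheory.EllipticCurves.RingClassField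
  Literature.NumberTheory.GaloisRepresentations Literature.NumberTheory.GaloisCohomology
  Literature.NumberTheory.NumberFields Literature.NumberTheory.DiophantineGeometry
  Summit.BirchSwinnertonDyer.Rank1Residual.X11b
  Summit.BirchSwinnertonDyer.BirchSwinnertonDyer.Theorems
  Summit.BirchSwinnertonDyer.BirchSwinnertonDyer.Theorems.ShimuraKolyvaginConjKLevel
  Summit.BirchSwinnertonDyer.BirchSwinnertonDyer.Theorems.ShimuraKolyvaginSurjHOfNamed
open Literature.NumberTheory.GaloisRepresentations.DiscreteGaloisModule (mu MuCarrier)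

/-- **π₃ᴿ ⟹ π₃**: the five-label PRIMITIVES supplier of shim3a's p496956 (binder `hPrim`, VERBATIM) from the four-label
one — the missing conjunct (B3₀) is `isOfFinAddOrder_map_sub_smul_of_labels` (p501287) applied to (B2) and (B3).
[cite: GrossLMS1991, §4 (4.1), §5 Prop. 5.3] [cite: BertoliniDarmon1996, §2.5, Prop. 2.6] -/
theorem shimuraPrimitives_of_reduced
    (hPrimR : ∀ (W : WeierstrassCurve ℚ) [W.IsElliptic] [W.IsGloballyMinimal] (p : ℕ) [Fact p.Prime]
      (N : ℕ) [NeZero N] (K : Type) [Field K] [NumberField K] (S : Finset ℕ)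
      (Dt : ModularParametrizationData W N)
      (X : ShimuraCurveData (∏ q ∈ S, q) (N / ∏ q ∈ S, q))
      (W' : WeierstrassCurve ℚ) [W'.IsElliptic] (P₀ : ShimuraParametrizationData X W'),
      W.conductorNorm ℤ = N → Literature.NumberTheory.EllipticCurves.Rank1Residual.Surj W 3 →
      p ≠ 2 → W.HasIrreducibleModPGaloisRep p →
      IsImaginaryQuadratic K → Even S.card →
      (∀ ℓ ∈ S, ℓ.Prime ∧ ℓ ∣ N ∧ ¬ ℓ ^ 2 ∣ N ∧
        ((Ideal.span {(ℓ : ℤ)}).primesOver (𝓞 K)).ncard = 1 ∧ ¬ (ℓ : ℤ) ∣ NumberField.discr K) →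
      (∀ ℓ : ℕ, ℓ.Prime → ℓ ∣ N → ℓ ∉ S → ((Ideal.span {(ℓ : ℤ)}).primesOver (𝓞 K)).ncard = 2) →
      ((Ideal.span {(p : ℤ)}).primesOver (𝓞 K)).ncard = 2 →
      P₀.IsMinimalFor W →
      p ∣ N → p = 3 →
      ∃ (ι : K →+* ℂ) (y : (m : ℕ) → (W.baseChange (ringClassField K ι m)).toAffine.Point)
        (yK : (W.baseChange K).toAffine.Point) (ε : ℤ) (degy : ℕ), 0 < degy ∧
        padicValNat p degy = padicValNat p P₀.deg ∧
        LDerivEK W K =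
            8 * (Real.pi : ℂ) ^ 2 * peterssonProduct (Gamma0 N) 2 Dt.f Dt.f /
                ((((Units.torsionOrder K : ℝ) / 2) ^ 2 * √|(NumberField.discr K : ℝ)| : ℝ) : ℂ) *
              ((yK.canonicalHeight : ℂ) / (degy : ℂ)) ∧
        (ε = 1 ∨ ε = -1) ∧
        (∀ T : Finset (ringClassField K ι 1 ≃ₐ[ℚ] ringClassField K ι 1),
          (∀ g, g ∈ T ↔ g ∈ ringClassGal ι 1) →
          WeierstrassCurve.Affine.Point.map (W' := W)
              (algebraMap K (ringClassField K ι 1)).toRatAlgHom yK =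
            ∑ g ∈ T, pointGalHom W (ringClassField K ι 1) g (y 1)) ∧
        (∀ (m : ℕ), m ≠ 0 → ∀ τm : ringClassField K ι m ≃ₐ[ℚ] ringClassField K ι m,
          (∀ x : ringClassField K ι m, ((τm x : ringClassField K ι m) : ℂ) = starRingEnd ℂ x) →
          ∃ σ' ∈ ringClassGal ι m, IsOfFinAddOrder
            (pointGalHom W (ringClassField K ι m) τm (y m) -
              ε • pointGalHom W (ringClassField K ι m) σ' (y m))) ∧
        (∀ m : ℕ, Squarefree m →
          (∀ q ∈ m.primeFactors, ¬ q ∣ N ∧ (Ideal.span {(q : 𝓞 K)}).IsPrime) →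
          ∀ (ℓ : ℕ) (_ : ℓ ∈ m.primeFactors) (hle : ringClassField K ι (m / ℓ) ≤ ringClassField K ι m)
            (σ : ringClassField K ι m ≃ₐ[ℚ] ringClassField K ι m),
            Subgroup.zpowers σ = ringClassGalOver ι m (m / ℓ) →
            letI : Algebra K ℂ := ι.toAlgebra
            ∑ i ∈ Finset.range (ℓ + 1), pointGalHom W (ringClassField K ι m) (σ ^ i) (y m) =
              W.frobeniusTrace ℓ • WeierstrassCurve.Affine.Point.map (W' := W)
                ((RingClassField.inclusion ι hle).restrictScalars ℚ) (y (m / ℓ))) ∧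
        (∀ m : ℕ, Squarefree m →
          (∀ q ∈ m.primeFactors, ¬ q ∣ N ∧ (Ideal.span {(q : 𝓞 K)}).IsPrime) →
          ∀ (ℓ : ℕ) (_ : ℓ ∈ m.primeFactors) [Fact ℓ.Prime] (hΔ : ¬ (ℓ : ℤ) ∣ minimalDiscriminantInt W)
            (φ₀ : absoluteGaloisGroup (ZMod ℓ)), (∀ x : AlgebraicClosure (ZMod ℓ), φ₀ • x = x ^ ℓ) →
          ∀ (hle : ringClassField K ι (m / ℓ) ≤ ringClassField K ι m)
            (emb : ringClassField K ι m →+* AlgebraicClosure K),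
            (∀ x : K, emb (algebraMap K (ringClassField K ι m) x) = algebraMap K (AlgebraicClosure K) x) →
          ∀ (j : (W.baseChange (ringClassField K ι m)).toAffine.Point →+ geomPoints (W.baseChange K)),
            j = WeierstrassCurve.Affine.Point.map (W' := W) emb.toRatAlgHom →
          ∀ γ : ringClassField K ι m ≃ₐ[ℚ] ringClassField K ι m, γ ∈ ringClassGal ι m →
            letI : Algebra K ℂ := ι.toAlgebra
            geomReduction hΔ ((RatClosure.pointsEquiv (K := K) W).symm
                (j (pointGalHom W (ringClassField K ι m) γ (y m)))) =
              φ₀ • geomReduction hΔ ((RatClosure.pointsEquiv (K := K) W).symm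
                (j (pointGalHom W (ringClassField K ι m) γ
                  (WeierstrassCurve.Affine.Point.map (W' := W)
                    ((RingClassField.inclusion ι hle).restrictScalars ℚ) (y (m / ℓ)))))))) :
    ∀ (W : WeierstrassCurve ℚ) [W.IsElliptic] [W.IsGloballyMinimal] (p : ℕ) [Fact p.Prime]
      (N : ℕ) [NeZero N] (K : Type) [Field K] [NumberField K] (S : Finset ℕ)
      (Dt : ModularParametrizationData W N)
      (X : ShimuraCurveData (∏ q ∈ S, q) (N / ∏ q ∈ S, q))
      (W' : WeierstrassCurve ℚ) [W'.IsElliptic] (P₀ : ShimuraParametrizationData X W'),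
      W.conductorNorm ℤ = N → Literature.NumberTheory.EllipticCurves.Rank1Residual.Surj W 3 →
      p ≠ 2 → W.HasIrreducibleModPGaloisRep p →
      IsImaginaryQuadratic K → Even S.card →
      (∀ ℓ ∈ S, ℓ.Prime ∧ ℓ ∣ N ∧ ¬ ℓ ^ 2 ∣ N ∧
        ((Ideal.span {(ℓ : ℤ)}).primesOver (𝓞 K)).ncard = 1 ∧ ¬ (ℓ : ℤ) ∣ NumberField.discr K) →
      (∀ ℓ : ℕ, ℓ.Prime → ℓ ∣ N → ℓ ∉ S → ((Ideal.span {(ℓ : ℤ)}).primesOver (𝓞 K)).ncard = 2) →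
      ((Ideal.span {(p : ℤ)}).primesOver (𝓞 K)).ncard = 2 →
      P₀.IsMinimalFor W →
      p ∣ N → p = 3 →
      ∃ (ι : K →+* ℂ) (y : (m : ℕ) → (W.baseChange (ringClassField K ι m)).toAffine.Point)
        (yK : (W.baseChange K).toAffine.Point) (ε : ℤ) (degy : ℕ), 0 < degy ∧
        padicValNat p degy = padicValNat p P₀.deg ∧
        LDerivEK W K =
            8 * (Real.pi : ℂ) ^ 2 * peterssonProduct (Gamma0 N) 2 Dt.f Dt.f /
                ((((Units.torsionOrder K : ℝ) / 2) ^ 2 * √|(NumberField.discr K : ℝ)| : ℝ) : ℂ) *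
              ((yK.canonicalHeight : ℂ) / (degy : ℂ)) ∧
        (ε = 1 ∨ ε = -1) ∧
        (∀ T : Finset (ringClassField K ι 1 ≃ₐ[ℚ] ringClassField K ι 1),
          (∀ g, g ∈ T ↔ g ∈ ringClassGal ι 1) →
          WeierstrassCurve.Affine.Point.map (W' := W)
              (algebraMap K (ringClassField K ι 1)).toRatAlgHom yK =
            ∑ g ∈ T, pointGalHom W (ringClassField K ι 1) g (y 1)) ∧
        (∀ (m : ℕ), m ≠ 0 → ∀ τm : ringClassField K ι m ≃ₐ[ℚ] ringClassField K ι m,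
          (∀ x : ringClassField K ι m, ((τm x : ringClassField K ι m) : ℂ) = starRingEnd ℂ x) →
          ∃ σ' ∈ ringClassGal ι m, IsOfFinAddOrder
            (pointGalHom W (ringClassField K ι m) τm (y m) -
              ε • pointGalHom W (ringClassField K ι m) σ' (y m))) ∧
        (∀ c : K ≃ₐ[ℚ] K, c ≠ 1 →
          IsOfFinAddOrder (WeierstrassCurve.Affine.Point.map (W' := W) (c : K →ₐ[ℚ] K) yK - ε • yK)) ∧
        (∀ m : ℕ, Squarefree m →
          (∀ q ∈ m.primeFactors, ¬ q ∣ N ∧ (Ideal.span {(q : 𝓞 K)}).IsPrime) →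
          ∀ (ℓ : ℕ) (_ : ℓ ∈ m.primeFactors) (hle : ringClassField K ι (m / ℓ) ≤ ringClassField K ι m)
            (σ : ringClassField K ι m ≃ₐ[ℚ] ringClassField K ι m),
            Subgroup.zpowers σ = ringClassGalOver ι m (m / ℓ) →
            letI : Algebra K ℂ := ι.toAlgebra
            ∑ i ∈ Finset.range (ℓ + 1), pointGalHom W (ringClassField K ι m) (σ ^ i) (y m) =
              W.frobeniusTrace ℓ • WeierstrassCurve.Affine.Point.map (W' := W)
                ((RingClassField.inclusion ι hle).restrictScalars ℚ) (y (m / ℓ))) ∧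
        (∀ m : ℕ, Squarefree m →
          (∀ q ∈ m.primeFactors, ¬ q ∣ N ∧ (Ideal.span {(q : 𝓞 K)}).IsPrime) →
          ∀ (ℓ : ℕ) (_ : ℓ ∈ m.primeFactors) [Fact ℓ.Prime] (hΔ : ¬ (ℓ : ℤ) ∣ minimalDiscriminantInt W)
            (φ₀ : absoluteGaloisGroup (ZMod ℓ)), (∀ x : AlgebraicClosure (ZMod ℓ), φ₀ • x = x ^ ℓ) →
          ∀ (hle : ringClassField K ι (m / ℓ) ≤ ringClassField K ι m)
            (emb : ringClassField K ι m →+* AlgebraicClosure K),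
            (∀ x : K, emb (algebraMap K (ringClassField K ι m) x) = algebraMap K (AlgebraicClosure K) x) →
          ∀ (j : (W.baseChange (ringClassField K ι m)).toAffine.Point →+ geomPoints (W.baseChange K)),
            j = WeierstrassCurve.Affine.Point.map (W' := W) emb.toRatAlgHom →
          ∀ γ : ringClassField K ι m ≃ₐ[ℚ] ringClassField K ι m, γ ∈ ringClassGal ι m →
            letI : Algebra K ℂ := ι.toAlgebra
            geomReduction hΔ ((RatClosure.pointsEquiv (K := K) W).symm
                (j (pointGalHom W (ringClassField K ι m) γ (y m)))) =
              φ₀ • geomReduction hΔ ((RatClosure.pointsEquiv (K := K) W).symm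
                (j (pointGalHom W (ringClassField K ι m) γ
                  (WeierstrassCurve.Affine.Point.map (W' := W)
                    ((RingClassField.inclusion ι hle).restrictScalars ℚ) (y (m / ℓ))))))) := by
  intro W _ _ p _ N _ K _ _ S Dt X W' _ P₀ hN hsurj hp2 hirr hK hS hin hsp hps hmin hpN hp3
  obtain ⟨ι, y, yK, ε, degy, h0y, hvy, hLy, hε, hB2, hB3, hB4, hB5⟩ :=
    hPrimR W p N K S Dt X W' P₀ hN hsurj hp2 hirr hK hS hin hsp hps hmin hpN hp3
  exact ⟨ι, y, yK, ε, degy, h0y, hvy, hLy, hε, hB2, hB3,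
    isOfFinAddOrder_map_sub_smul_of_labels hK ι y hB2 hB3, hB4, hB5⟩

/-- **Stub H `stub_orderBoundSurj_heegnerPointAtThree` (registered signature VERBATIM) ⟸ Poitou–Tate, GZK over `ℚ`,
modularity, the Literature fact `casselsTate_levelInputs` (every `K`) and the REDUCED primitives π₃ᴿ** — shim3a's
p499393 fed with `shimuraPrimitives_of_reduced`. HONEST: conditional; H as registered stays OPEN.
[cite: McCallumLMS1991, §1 Theorem (Kolyvagin)] [cite: MilneADT2006, Ch. I §6 Thm. 6.13(a)] [cite: JetchevSkinnerWan2017, Thm. 4.4.1 (p. 19)] -/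
theorem stub_orderBoundSurj_heegnerPointAtThree_of_poitouTate_of_GZK_of_modularity_of_casselsTateLevelInputs_of_reducedPrimitives
    (hPT : ∀ (K : Type) [Field K] [NumberField K], poitouTate_sum_localTatePairing_eq_zero K)
    (hGZK : rank_eq_analyticRank_of_analyticRank_le_one) (hE : WeierstrassCurve.hasEntireLFunction_rat)
    (hCTf : ∀ (K : Type) [Field K] [NumberField K], casselsTate_levelInputs K)
    (hPrimR : ∀ (W : WeierstrassCurve ℚ) [W.IsElliptic] [W.IsGloballyMinimal] (p : ℕ) [Fact p.Prime]
      (N : ℕ) [NeZero N] (K : Type) [Field K] [NumberField K] (S : Finset ℕ)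
      (Dt : ModularParametrizationData W N)
      (X : ShimuraCurveData (∏ q ∈ S, q) (N / ∏ q ∈ S, q))
      (W' : WeierstrassCurve ℚ) [W'.IsElliptic] (P₀ : ShimuraParametrizationData X W'),
      W.conductorNorm ℤ = N → Literature.NumberTheory.EllipticCurves.Rank1Residual.Surj W 3 →
      p ≠ 2 → W.HasIrreducibleModPGaloisRep p →
      IsImaginaryQuadratic K → Even S.card →
      (∀ ℓ ∈ S, ℓ.Prime ∧ ℓ ∣ N ∧ ¬ ℓ ^ 2 ∣ N ∧
        ((Ideal.span {(ℓ : ℤ)}).primesOver (𝓞 K)).ncard = 1 ∧ ¬ (ℓ : ℤ) ∣ NumberField.discr K) →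
      (∀ ℓ : ℕ, ℓ.Prime → ℓ ∣ N → ℓ ∉ S → ((Ideal.span {(ℓ : ℤ)}).primesOver (𝓞 K)).ncard = 2) →
      ((Ideal.span {(p : ℤ)}).primesOver (𝓞 K)).ncard = 2 →
      P₀.IsMinimalFor W →
      p ∣ N → p = 3 →
      ∃ (ι : K →+* ℂ) (y : (m : ℕ) → (W.baseChange (ringClassField K ι m)).toAffine.Point)
        (yK : (W.baseChange K).toAffine.Point) (ε : ℤ) (degy : ℕ), 0 < degy ∧
        padicValNat p degy = padicValNat p P₀.deg ∧
        LDerivEK W K =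
            8 * (Real.pi : ℂ) ^ 2 * peterssonProduct (Gamma0 N) 2 Dt.f Dt.f /
                ((((Units.torsionOrder K : ℝ) / 2) ^ 2 * √|(NumberField.discr K : ℝ)| : ℝ) : ℂ) *
              ((yK.canonicalHeight : ℂ) / (degy : ℂ)) ∧
        (ε = 1 ∨ ε = -1) ∧
        (∀ T : Finset (ringClassField K ι 1 ≃ₐ[ℚ] ringClassField K ι 1),
          (∀ g, g ∈ T ↔ g ∈ ringClassGal ι 1) →
          WeierstrassCurve.Affine.Point.map (W' := W)
              (algebraMap K (ringClassField K ι 1)).toRatAlgHom yK =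
            ∑ g ∈ T, pointGalHom W (ringClassField K ι 1) g (y 1)) ∧
        (∀ (m : ℕ), m ≠ 0 → ∀ τm : ringClassField K ι m ≃ₐ[ℚ] ringClassField K ι m,
          (∀ x : ringClassField K ι m, ((τm x : ringClassField K ι m) : ℂ) = starRingEnd ℂ x) →
          ∃ σ' ∈ ringClassGal ι m, IsOfFinAddOrder
            (pointGalHom W (ringClassField K ι m) τm (y m) -
              ε • pointGalHom W (ringClassField K ι m) σ' (y m))) ∧
        (∀ m : ℕ, Squarefree m →
          (∀ q ∈ m.primeFactors, ¬ q ∣ N ∧ (Ideal.span {(q : 𝓞 K)}).IsPrime) →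
          ∀ (ℓ : ℕ) (_ : ℓ ∈ m.primeFactors) (hle : ringClassField K ι (m / ℓ) ≤ ringClassField K ι m)
            (σ : ringClassField K ι m ≃ₐ[ℚ] ringClassField K ι m),
            Subgroup.zpowers σ = ringClassGalOver ι m (m / ℓ) →
            letI : Algebra K ℂ := ι.toAlgebra
            ∑ i ∈ Finset.range (ℓ + 1), pointGalHom W (ringClassField K ι m) (σ ^ i) (y m) =
              W.frobeniusTrace ℓ • WeierstrassCurve.Affine.Point.map (W' := W)
                ((RingClassField.inclusion ι hle).restrictScalars ℚ) (y (m / ℓ))) ∧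
        (∀ m : ℕ, Squarefree m →
          (∀ q ∈ m.primeFactors, ¬ q ∣ N ∧ (Ideal.span {(q : 𝓞 K)}).IsPrime) →
          ∀ (ℓ : ℕ) (_ : ℓ ∈ m.primeFactors) [Fact ℓ.Prime] (hΔ : ¬ (ℓ : ℤ) ∣ minimalDiscriminantInt W)
            (φ₀ : absoluteGaloisGroup (ZMod ℓ)), (∀ x : AlgebraicClosure (ZMod ℓ), φ₀ • x = x ^ ℓ) →
          ∀ (hle : ringClassField K ι (m / ℓ) ≤ ringClassField K ι m)
            (emb : ringClassField K ι m →+* AlgebraicClosure K),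
            (∀ x : K, emb (algebraMap K (ringClassField K ι m) x) = algebraMap K (AlgebraicClosure K) x) →
          ∀ (j : (W.baseChange (ringClassField K ι m)).toAffine.Point →+ geomPoints (W.baseChange K)),
            j = WeierstrassCurve.Affine.Point.map (W' := W) emb.toRatAlgHom →
          ∀ γ : ringClassField K ι m ≃ₐ[ℚ] ringClassField K ι m, γ ∈ ringClassGal ι m →
            letI : Algebra K ℂ := ι.toAlgebra
            geomReduction hΔ ((RatClosure.pointsEquiv (K := K) W).symm
                (j (pointGalHom W (ringClassField K ι m) γ (y m)))) =
              φ₀ • geomReduction hΔ ((RatClosure.pointsEquiv (K := K) W).symm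
                (j (pointGalHom W (ringClassField K ι m) γ
                  (WeierstrassCurve.Affine.Point.map (W' := W)
                    ((RingClassField.inclusion ι hle).restrictScalars ℚ) (y (m / ℓ)))))))) :
  ∀ (W : WeierstrassCurve ℚ) [W.IsElliptic] [W.IsGloballyMinimal] (p : ℕ) [Fact p.Prime]
    (N : ℕ) [NeZero N] (K : Type) [Field K] [NumberField K] (S : Finset ℕ)
    (Dt : ModularParametrizationData W N)
    (X : ShimuraCurveData (∏ q ∈ S, q) (N / ∏ q ∈ S, q))
    (W' : WeierstrassCurve ℚ) [W'.IsElliptic] (P₀ : ShimuraParametrizationData X W'),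
    W.conductorNorm ℤ = N → Literature.NumberTheory.EllipticCurves.Rank1Residual.Surj W 3 →
    p ≠ 2 → W.HasIrreducibleModPGaloisRep p →
    IsImaginaryQuadratic K → Even S.card →
    (∀ ℓ ∈ S, ℓ.Prime ∧ ℓ ∣ N ∧ ¬ ℓ ^ 2 ∣ N ∧
      ((Ideal.span {(ℓ : ℤ)}).primesOver (𝓞 K)).ncard = 1 ∧ ¬ (ℓ : ℤ) ∣ NumberField.discr K) →
    (∀ ℓ : ℕ, ℓ.Prime → ℓ ∣ N → ℓ ∉ S → ((Ideal.span {(ℓ : ℤ)}).primesOver (𝓞 K)).ncard = 2) →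
    ((Ideal.span {(p : ℤ)}).primesOver (𝓞 K)).ncard = 2 →
    P₀.IsMinimalFor W →
    p ∣ N → p = 3 →
    ∃ (P : (W.baseChange K).toAffine.Point) (degS : ℕ), 0 < degS ∧
      padicValNat p degS = padicValNat p P₀.deg ∧
      LDerivEK W K =
          8 * (Real.pi : ℂ) ^ 2 * peterssonProduct (Gamma0 N) 2 Dt.f Dt.f /
              ((((Units.torsionOrder K : ℝ) / 2) ^ 2 * √|(NumberField.discr K : ℝ)| : ℝ) : ℂ) *
            ((P.canonicalHeight : ℂ) / (degS : ℂ)) ∧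
      (¬ IsOfFinAddOrder P →
        Nat.card (AddCommGroup.primaryComponent (W.baseChange K).sha p) ≤
            p ^ (2 * padicValNat p (AddSubgroup.zmultiples P).index)) :=
  stub_orderBoundSurj_heegnerPointAtThree_of_poitouTate_of_GZK_of_modularity_of_casselsTateLevelInputs_of_shimuraPrimitives
    hPT hGZK hE hCTf (shimuraPrimitives_of_reduced hPrimR)

end Summit.BirchSwinnertonDyer.BirchSwinnertonDyer.Theorems.ShimuraKolyvaginSurjPrimitivesReduced

end
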